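import Literature.NumberTheory.Rogawski1990.ArchBouazizWallSurjectiveOfBricks   -- ★ p851580 (W5-pre): `bzLocalSurjWall_of_bricks`; brings ★ (W4), ★ (W12-asm), ★ (W0)
import Literature.NumberTheory.Rogawski1990.ArchBouazizWallFrame                -- ★ p851584∕p851588 (W5-frame, LH1-p03 (g7)): (F1) (F2) (F3) verbatim twins
import Literature.NumberTheory.Rogawski1990.ArchBouazizZeroJumpGluing           -- ★ p851593 (W1)+(W1′), LH7-p04 (g6): `exists_contDiffOn_tube_eq_archERho_mul_of_eq_zero_central`
import Literature.NumberTheory.Rogawski1990.ArchBouazizWallGenerators          -- ★ p851621 (W3-asm), F0P3a-p08 (g24): `wallGenerators_bricks_of_parts`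
import Literature.NumberTheory.Rogawski1990.ArchRankOneWallGenerators          -- ★ p851615 (W3-G).2b, LH3-p02 (g5): `exists_splitType_wallGenerator`
import Literature.NumberTheory.Rogawski1990.ArchRankOneWallGeneratorsTwoSided  -- ★ p851635 (W3-G).3b, LH3-p02 (g5): `exists_compactType_wallGenerator_twoSided`
import Literature.NumberTheory.Rogawski1990.ArchBouazizClassFunctionRealisation -- ★ p851658 (W2c), F0P3a-p06 (g20) ⊕ A-p12 (g28): `exists_contDiff_classFunction_of_parity`
import HarnessLib

/-!
# BOUAZIZ'S SURJECTIVITY AT A WALL BASE CLASS, IN HOUSE — the PAYER of the organ O-L3′-S-WALL of the leaf `F0_P3c_StubN9Direct` (`BzLocalSurjWallStatement`, = the `hwall` binder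
# of ★ `bouazizSurjOfForward_of_reg_wall`): for a jump datum `jcH` carrying every stable orbital family, every member of `I^st_c(jcH)` is, near a base class with a CENTRAL block,
# the stable orbital family of a test function (Bouaziz 1994 ASENS 27 §4 proof of Thm 4.1.1, §5.1–5.2, Thm. 6.2.1 (i); Shelstad 1979 §4 Thm. 4.7)

Topic `NumberTheory/Rogawski1990`; namespace `Literature.NumberTheory.Rogawski1990`.  THEOREMS ONLY (no `def`, no instance, no notation, no axiom, no named fact, no `sorry`).  Cell
`pub/hodgecm-mathlib`, crux H413 (`stmt-HodgeConjecture-24833`), line LH3 (closer stub `stub_N9`, DIRECT ROAD), letter L3′ (Bouaziz's isomorphism), organ O-L3′-S-WALL — until today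
THE PRINT ORGAN of the S-road (RULING #23: «rank-one inversion with parameters at a k-fold compact-wall base point; no étale section at ψ = x = 0»).  W-ROAD (census LH3-p01 (g6)
6129001bfae4ccc0, dealer RULING #26): the FILTRATION ROAD — Bouaziz's own finite filtration by split rank, specialised to `H_∞ = U(1,1)^W × U(1)^W` — needs no chart at the centre:
* ★ (W0) class tubes `ArchBouazizClassMapWallTube` (LH1-p03 (g7), p851565) · ★ (W5-frame) `ArchBouazizWallFrame` (LH1-p03, p851584∕p851588);
* ★ (W1)+(W1′) multi-wall ZERO-JUMP GLUING `ArchBouazizZeroJumpGluing` (LH7-p04 (g6), p851593);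
* ★ (W2a) parity normal form `ParityNormalForm` (A-p12 (g28)) · ★ (W2b) `ImmersionLeftInverse` (F0P3a-p06 (g20), p851563) · ★ (W2c) class realisation `ArchBouazizClassFunctionRealisation` (F0P3a-p06);
* ★ (W3-T) `ArchSmooth2AmbientMultiplier` (F0P3a-p09 (g8)) · ★ (W3-G) `ArchRankOneWallSplitReading` ∕ `ArchRankOneWallGenerators` (LH3-p02 (g5)) · ★ (W3-asm) `ArchBouazizWallGenerators` (F0P3a-p08 (g24));
* ★ (W4) THE FILTRATION ASSEMBLY `ArchBouazizWallSurjectiveAssembly` (p851574) · ★ (W12-asm) `ArchBouazizWallClassMultiple` (p851576) · ★ (W5-pre) `ArchBouazizWallSurjectiveOfBricks` (p851580) (LH3-p01 (g6)).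
Author LH3-p01 (g6).  Lane `--kind proof --supports stmt-HodgeConjecture-24833`.

THE THEOREM `bzLocalSurjWall (L νH) (jcH) (hfwd) (b) (hb)`: for EVERY Haar frame `(L, νH)`, every datum `jcH` with `stOrbFamH νH fH ∈ ArchBouazizSpaceH jcH` for all `fH ∈ C_c^∞(H_∞)`
(the forward half ★ p851464 supplies it), and every base class `b` with `(b w).1² = 4 (b w).2.1` at SOME place: `∃ ε > 0, ∀ Ψ ∈ ArchBouazizSpaceH jcH, ∃ fH ∈ C_c^∞(H_∞)` with
`stOrbFamH L νH fH S c = Ψ S c` whenever `c ∈ RegS S` and `dist (bzClassMap S c) b < ε` — the matrix of the leaf's `BzLocalSurjWallStatement` after its frame binders (the jump-constant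
non-vanishing `hne` of the leaf frame is not needed and not taken; the leaf pays by `fun L _ _ _ _ _ νH _ _ jcH _ hfwd b hb => bzLocalSurjWall L νH jcH hfwd b hb`).
PROOF = ★ `bzLocalSurjWall_of_bricks` fed with the six ★ bricks by bare names (three 4-line `Finset.filter` adapters).
HONEST LABEL: with this file letter L3′ of `stub_N9` is IN HOUSE end to end (O-L3′-F ★ p851464, O-L3′-S-REG ★ p851586, O-L3′-S-WALL here); the line `F0_P3c_StubN9Direct` moves no row of
the books by itself; HC_CM is proved only modulo the 7 printed citations (2 remaining named inputs: hLiu418 = stmt-HodgeConjecture-24832, h413 = stmt-HodgeConjecture-24833) until rung 0 closes.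

## References
* [Bouaziz1994IntegralesOrbitales] A. Bouaziz, *Intégrales orbitales sur les groupes de Lie réductifs*, Ann. Sci. ÉNS (4) 27 (1994) 573–609, §4 Thm 4.1.1 and its proof pp. 585–586
  («J induit une surjection du gradué associé à la filtration … donc J est surjective car les filtrations sont finies»), §5.1–5.2 pp. 588–590, Thm. 6.2.1 (i) p. 592.
* [Bouaziz1994Invent115] A. Bouaziz, *Intégrales orbitales sur les algèbres de Lie réductives*, Invent. Math. 115 (1994), Thm 4.1.1, Lemma 10.1.1.
* [Shelstad1979] D. Shelstad, *Characters and inner forms of a quasi-split group over ℝ*, Compositio Math. 39 (1979), §4, Thm. 4.7 p. 31.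
* [Varadarajan1989] V. S. Varadarajan, *An Introduction to Harmonic Analysis on Semisimple Lie Groups* (1989), §6.4 Thm 22 (Harish-Chandra's limit formula, the compact-type generator).
-/

set_option autoImplicit false

noncomputable section

open MeasureTheory NumberField NumberField.InfinitePlace Complex Set Function Filter Topology
open Literature.NumberTheory.Automorphic Literature.NumberTheory.Automorphic.UnitaryGroup Literature.NumberTheory.Automorphic.ArchCartan
open scoped Classical ContDiff Topology MatrixGroups Matrix Matrix.Norms.Operator

namespace Literature.NumberTheory.Rogawski1990

section Payer

variable (L : Type) [Field L] [NumberField L] [IsCMField L]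
  [MeasurableSpace (↥(arch (↥(maximalRealSubfield L)) L (IsCMField.complexConj L) 2 (Matrix.of fun i j : Fin 2 => if i.val + j.val + 1 = 2 then (1 : L) else 0)) ×
      ↥(arch (↥(maximalRealSubfield L)) L (IsCMField.complexConj L) 1 (Matrix.of fun i j : Fin 1 => if i.val + j.val + 1 = 1 then (1 : L) else 0)))]
  [BorelSpace (↥(arch (↥(maximalRealSubfield L)) L (IsCMField.complexConj L) 2 (Matrix.of fun i j : Fin 2 => if i.val + j.val + 1 = 2 then (1 : L) else 0)) ×
      ↥(arch (↥(maximalRealSubfield L)) L (IsCMField.complexConj L) 1 (Matrix.of fun i j : Fin 1 => if i.val + j.val + 1 = 1 then (1 : L) else 0)))]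
  (νH : Measure (↥(arch (↥(maximalRealSubfield L)) L (IsCMField.complexConj L) 2 (Matrix.of fun i j : Fin 2 => if i.val + j.val + 1 = 2 then (1 : L) else 0)) ×
      ↥(arch (↥(maximalRealSubfield L)) L (IsCMField.complexConj L) 1 (Matrix.of fun i j : Fin 1 => if i.val + j.val + 1 = 1 then (1 : L) else 0))))
  [νH.IsHaarMeasure] [νH.IsMulRightInvariant]

/-- **BOUAZIZ'S SURJECTIVITY AT A WALL BASE CLASS — the `hwall` organ of ★ `bouazizSurjOfForward_of_parts`, IN HOUSE** (see the module docstring): near a base class `b` with a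
central block at some place, every `Ψ ∈ ArchBouazizSpaceH jcH` is the stable orbital family of some `fH ∈ C_c^∞(H_∞)` on the regular `ε`-tube of `b`, with ONE `ε` for all `Ψ`.
Bouaziz's finite filtration (★ `bzLocalSurjWall_of_parts`) fed with the class tubes and frame (★ (W0)/(W5-frame)), the zero-jump gluing (★ (W1′)), the class-function realisation at a
fibre point (★ (W2c)) and the tensor generators with Harish-Chandra's limit formula (★ (W3-asm)). [cite: Bouaziz1994IntegralesOrbitales, §4 pp. 585–586; §5.1–5.2 pp. 588–590; Thm. 6.2.1 (i) p. 592]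
[cite: Shelstad1979, Thm. 4.7 (p. 31)] [cite: Varadarajan1989, §6.4 Thm 22] -/
theorem bzLocalSurjWall (jcH : Finset {w : InfinitePlace L // IsComplex w} → {w : InfinitePlace L // IsComplex w} → ℂ)
    (hfwd : ∀ fH : ↥(arch (↥(maximalRealSubfield L)) L (IsCMField.complexConj L) 2 (Matrix.of fun i j : Fin 2 => if i.val + j.val + 1 = 2 then (1 : L) else 0)) ×
      ↥(arch (↥(maximalRealSubfield L)) L (IsCMField.complexConj L) 1 (Matrix.of fun i j : Fin 1 => if i.val + j.val + 1 = 1 then (1 : L) else 0)) → ℂ,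
      ArchSmooth₂ L fH → ArchBouazizSpaceH jcH (stOrbFamH L νH fH))
    (b : {w : InfinitePlace L // IsComplex w} → ℂ × ℂ × ℂ) (hb : ∃ w, (b w).1 ^ 2 = 4 * (b w).2.1) :
    ∃ ε : ℝ, 0 < ε ∧ ∀ Ψ : Finset {w : InfinitePlace L // IsComplex w} → ({w : InfinitePlace L // IsComplex w} → Fin 3 → ℝ) → ℂ, ArchBouazizSpaceH jcH Ψ →
      ∃ fH : ↥(arch (↥(maximalRealSubfield L)) L (IsCMField.complexConj L) 2 (Matrix.of fun i j : Fin 2 => if i.val + j.val + 1 = 2 then (1 : L) else 0)) ×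
        ↥(arch (↥(maximalRealSubfield L)) L (IsCMField.complexConj L) 1 (Matrix.of fun i j : Fin 1 => if i.val + j.val + 1 = 1 then (1 : L) else 0)) → ℂ,
        ArchSmooth₂ L fH ∧ ∀ (S : Finset {w : InfinitePlace L // IsComplex w}) (c : {w : InfinitePlace L // IsComplex w} → Fin 3 → ℝ),
          c ∈ RegS S → dist (bzClassMap S c) b < ε → stOrbFamH L νH fH S c = Ψ S c := by
  -- ★ BRICK (W1′) — LH7-p04 (g6) p851593 ED. 2 `exists_contDiffOn_tube_eq_archERho_mul_of_eq_zero_central` (bare name, `hW1` token for token)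
  -- THE FRAME (★ (W5-frame) ED. 2, LH1-p03 (g7): verbatim twins) and the assembly (★ (W5-pre))
  exact bzLocalSurjWall_of_bricks L νH jcH hfwd (fun b S_b c_b hb => exists_forall_sdiff_eq_filter_of_dist_bzClassMap_lt hb)
    (fun b S_b c_b hb T hT => exists_fibrePoint_wall_bricks b S_b c_b hb T hT) (fun b => exists_forall_circleExp_ne_of_dist_bzClassMap_lt_bricks b)
    (exists_contDiffOn_tube_eq_archERho_mul_of_eq_zero_central jcH)
    (fun S P T c₀ hPS hTS hP hT hSreg hCreg δ hδ => exists_contDiff_classFunction_of_parity S P T hPS hTS hP hT hSreg hCreg hδ)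
    (wallGenerators_bricks_of_parts L νH (fun w _ _ νw _ _ θ₀ U hU => exists_splitType_wallGenerator L w νw θ₀ hU)
      (fun w _ _ νw _ _ θ₀ U hU => exists_compactType_wallGenerator_twoSided L w νw θ₀ hU)) b hb

end Payer

end Literature.NumberTheory.Rogawski1990

end
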